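import Summits.CriticalPhenomena.CardyFormulaZ2.Theorems.CardyComplexConeEdgePrecompactUFRSMarkedDecayRectLocal
import Summits.CriticalPhenomena.CardyFormulaZ2.Theorems.CardyComplexConeEdgePrecompactUFRSMarkedDecayRectMono

/-!
# UFRS, decay of the JUNCTION alternative at the marked points
(line `qkz-strip-boundary-arm` of crux `CardyComplexCone.EdgePrecompact`, stmt-CriticalPhenomena-11387;
support for the reshaping of the residual `ufrs_initialExitNearCase_cert` of the corrected arm
domination `ufrs_armDomination2`, cf. `…UFRSInitialExitNearStrands.lean`)

The residual INITIAL configuration with a nearby exit is certified at the start vertex by the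
NAMED strands only in the two-scale JUNCTION form of `ufrs_initialExitNear_junction`: a marked
edge within `r = 4η` of the collar point `z`, a dyadic radius `R' = ρ/4/2^(k+1) ≥ 32 r`, two
strand-crossings of `A(z; r, R')` and two strand-crossings of `A(z; 4R', ρ/4)` — an alternative
which is not a branch of `ufrsCert`. This file shows that the alternative is as cheap as the NEAR
branch (`ufrs_nearBranch_le_W3M`), uniformly in the datum: `ufrs_junctionBranch_le` bounds the
probability of "some collar point of `Ω` carries the junction data" by
`4 L C² (1024 η/ρ)^β`, `L = log₂⌈ρ/η⌉ + 1`, given the junction two-strand decay (constants `C`,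
`β`) at the (at most four) marked edges of `E` and `shiftData E w` — the registered bridge
`ufrs_rect_junctionTwoStrandDecay` on rectangles. Proof: re-centre both strand families at the
marked edge `m` within `4η` of `z` (`ufrsStrands_mono_W3M`): two crossings of `A(m; 8η, R' - 4η)` and
two of `A(m; 4R' + 4η, ρ/4 - 4η)`; the two edge annuli are disjoint, so the probabilities multiply
(`real_inter_ufrsStrands_W3M`) to `≤ C (16η/R')^β · C (64 R'/ρ)^β = C² (1024 η/ρ)^β`; sum over the
marked edges and the `< L` dyadic exponents (as in `lt_logCeil_W3M`).

References: G. F. Lawler, O. Schramm, W. Werner, Electron. J. Probab. 7 (2002), Appendix A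
(half-plane arm exponents); P. Nolin, Electron. J. Probab. 13 (2008), §4 (arm events in
consecutive annuli, quasi-multiplicativity is not needed here: disjoint annuli are independent).
-/

namespace Summit.CriticalPhenomena.CardyFormulaZ2.Cruxes.EdgePrecompact.QkzStripBoundaryArm

open MeasureTheory Filter Set Metric
open scoped Topology BigOperators Pointwise
open Literature.Probability.LatticeModels Literature.Probability.Percolation
open Literature.Probability.RandomPlanarGeometry (DobrushinDomain)
open Summit.CriticalPhenomena.CardyFormulaZ2.Theses.CardyComplexCone

noncomputable section

/-- **Decay of the JUNCTION alternative.** For an admissible datum `E` with `E.δ ≤ η`, a shift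
`w`, `0 < η ≤ ρ/4096`, and the junction two-strand decay with constants `C ≥ 0`, `β > 0` at the
marked edges of `E` and of `shiftData E w` (hypothesis `hJ`, the shape of
`ufrs_rect_junctionTwoStrandDecay`), the event "some point `z ∈ Ω` of the `3η`-collar of `Ω` has
a marked edge within `4η`, a dyadic radius `R' = ρ/4/2^(k+1)` with `32 · 4η ≤ R'`, two
strand-crossings of `A(z; 4η, R')` and two strand-crossings of `A(z; 4R', ρ/4)`" has probability
at most `4 (log₂⌈ρ/η⌉ + 1) C² (1024 η/ρ)^β`. -/
theorem ufrs_junctionBranch_le : ∀ (E : DiscreteDobrushin) (w : Site 2) (η ρ C β : ℝ), E.IsZdAdmissible → E.δ ≤ η → 0 < η → η ≤ ρ / 4096 → 0 ≤ C → 0 < β → (∀ e₀ : Sym2 (Site 2), (e₀ ∈ E.zdABEdges ∨ e₀ ∈ (shiftData E w).zdABEdges) → ∀ s S : ℝ, η ≤ s → 0 < S → (bondPercolation (zdGraph 2) half).real (ufrsStrands E w (medialPoint E.δ e₀) 2 s S) ≤ C * (s / S) ^ β) → ∀ Ω : Set ℂ, (bondPercolation (zdGraph 2) half).real {ω : BondConfig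 (Site 2) | ∃ z ∈ Ω, infDist z Ωᶜ < 3 * η ∧ z ∈ ufrsMarkedNbhd E w (4 * η) ∧ ∃ R' : ℝ, (∃ k : ℕ, R' = ρ / 2 / 2 / 2 ^ (k + 1)) ∧ 32 * (4 * η) ≤ R' ∧ ω ∈ ufrsStrands E w z 2 (4 * η) R' ∧ ω ∈ ufrsStrands E w z 2 (4 * R') (ρ / 2 / 2)} ≤ 4 * ((Nat.log 2 ⌈ρ / η⌉₊ + 1 : ℕ) : ℝ) * C ^ 2 * (1024 * η / ρ) ^ β := by
  intro E w η ρ C β hE hδη hη hηρ hC hβ hJ Ω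
  classical
  have hρ : 0 < ρ := by linarith
  have hδ : 0 < E.δ := hE.delta_pos
  set μ := bondPercolation (zdGraph 2) half with hμ
  set L : ℕ := Nat.log 2 ⌈ρ / η⌉₊ + 1 with hL
  set M := (finite_markedEdges_W3M hE w).toFinset with hM
  -- the dyadic radii and the per-edge, per-scale events
  obtain ⟨Rk, hRk⟩ : ∃ Rk : ℕ → ℝ, Rk = fun k => ρ / 2 / 2 / 2 ^ (k + 1) := ⟨_, rfl⟩
  have hRkpos : ∀ k, 0 < Rk k := fun k => by rw [hRk]; positivity
  obtain ⟨G, hG⟩ : ∃ G : Sym2 (Site 2) → ℕ → Set (BondConfig (Site 2)), G = fun e₀ k =>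
    {ω : BondConfig (Site 2) | 32 * (4 * η) ≤ Rk k ∧ ω ∈ ufrsStrands E w (medialPoint E.δ e₀) 2 (8 * η) (Rk k - 4 * η) ∩
      ufrsStrands E w (medialPoint E.δ e₀) 2 (4 * Rk k + 4 * η) (ρ / 2 / 2 - 4 * η)} := ⟨_, rfl⟩
  have hKnonneg : 0 ≤ C ^ 2 * (1024 * η / ρ) ^ β := by positivity
  -- the per-term bound: independence of the two disjoint annuli and the two junction decays
  have hterm : ∀ e₀ ∈ M, ∀ k : ℕ, μ.real (G e₀ k) ≤ C ^ 2 * (1024 * η / ρ) ^ β := by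
    intro e₀ he₀M k
    have he₀ := (mem_markedEdges_toFinset_W3M hE w e₀).1 he₀M
    by_cases hg : 32 * (4 * η) ≤ Rk k
    · have hGeq : G e₀ k = ufrsStrands E w (medialPoint E.δ e₀) 2 (8 * η) (Rk k - 4 * η) ∩
          ufrsStrands E w (medialPoint E.δ e₀) 2 (4 * Rk k + 4 * η) (ρ / 2 / 2 - 4 * η) := by
        ext ω
        simp only [hG, Set.mem_setOf_eq, Set.mem_inter_iff]
        exact ⟨fun h => h.2, fun h => ⟨hg, h⟩⟩
      rw [hGeq, real_inter_ufrsStrands_W3M E w hδ (fun x _ h2 h3 _ => by linarith [hRkpos k])]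
      have h1 : μ.real (ufrsStrands E w (medialPoint E.δ e₀) 2 (8 * η) (Rk k - 4 * η)) ≤ C * (16 * η / Rk k) ^ β := by
        refine le_trans (hJ e₀ he₀ _ _ (by linarith) (by linarith)) ?_
        refine mul_le_mul_of_nonneg_left (Real.rpow_le_rpow
          (div_nonneg (by positivity) (by linarith [hRkpos k])) ?_ hβ.le) hC
        rw [div_le_div_iff₀ (by linarith) (hRkpos k)]
        nlinarith [mul_nonneg hη.le (sub_nonneg.2 (by linarith : 8 * η ≤ Rk k))]
      have h2 : μ.real (ufrsStrands E w (medialPoint E.δ e₀) 2 (4 * Rk k + 4 * η) (ρ / 2 / 2 - 4 * η)) ≤ C * (64 * Rk k / ρ) ^ β := by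
        refine le_trans (hJ e₀ he₀ _ _ (by linarith [hRkpos k]) (by linarith)) ?_
        refine mul_le_mul_of_nonneg_left (Real.rpow_le_rpow
          (div_nonneg (by linarith [hRkpos k]) (by linarith)) ?_ hβ.le) hC
        rw [div_le_div_iff₀ (by linarith) hρ]
        have a1 := mul_le_mul_of_nonneg_right hg hρ.le
        have a2 := mul_le_mul_of_nonneg_right hηρ (hRkpos k).le
        nlinarith [hRkpos k]
      have hx : 0 ≤ 16 * η / Rk k := div_nonneg (by positivity) (hRkpos k).le
      have hy : 0 ≤ 64 * Rk k / ρ := div_nonneg (by linarith [hRkpos k]) hρ.le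
      calc μ.real (ufrsStrands E w (medialPoint E.δ e₀) 2 (8 * η) (Rk k - 4 * η)) *
            μ.real (ufrsStrands E w (medialPoint E.δ e₀) 2 (4 * Rk k + 4 * η) (ρ / 2 / 2 - 4 * η))
          ≤ (C * (16 * η / Rk k) ^ β) * (C * (64 * Rk k / ρ) ^ β) :=
            mul_le_mul h1 h2 measureReal_nonneg (mul_nonneg hC (Real.rpow_nonneg hx _))
        _ = C ^ 2 * ((16 * η / Rk k) * (64 * Rk k / ρ)) ^ β := by
            rw [Real.mul_rpow hx hy]; ring
        _ = C ^ 2 * (1024 * η / ρ) ^ β := by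
            have hRk0 : Rk k ≠ 0 := (hRkpos k).ne'
            congr 2
            field_simp
            ring
    · have hGeq : G e₀ k = ∅ := by
        ext ω
        simp only [hG, Set.mem_setOf_eq, Set.mem_empty_iff_false, iff_false, not_and]
        exact fun h => absurd h hg
      rw [hGeq, measureReal_empty]
      exact hKnonneg
  -- the cover by the per-edge, per-scale events
  have hcover : {ω : BondConfig (Site 2) | ∃ z ∈ Ω, infDist z Ωᶜ < 3 * η ∧ z ∈ ufrsMarkedNbhd E w (4 * η) ∧ ∃ R' : ℝ, (∃ k : ℕ, R' = ρ / 2 / 2 / 2 ^ (k + 1)) ∧ 32 * (4 * η) ≤ R' ∧ ω ∈ ufrsStrands E w z 2 (4 * η) R' ∧ ω ∈ ufrsStrands E w z 2 (4 * R') (ρ / 2 / 2)} ⊆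
      ⋃ e₀ ∈ M, ⋃ k ∈ Finset.range L, G e₀ k := by
    rintro ω ⟨z, -, -, hmk, R', ⟨k, rfl⟩, hge, h₁, h₂⟩
    rw [mem_ufrsMarkedNbhd_iff] at hmk
    obtain ⟨e₀, he₀, hd⟩ := hmk
    have hRk' : ρ / 2 / 2 / 2 ^ (k + 1) = Rk k := by rw [hRk]
    rw [hRk'] at hge h₁ h₂
    -- the exponent is logarithmically small
    have hkL : k < L := by
      -- `2^k ≤ ρ/η` forces `k < log₂ ⌈ρ/η⌉ + 1` (as in `lt_logCeil_W3M`)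
      have h2k : (2 : ℝ) ^ k ≤ ρ / η := by
        have e1 : Rk k * 2 ^ (k + 1) = ρ / 4 := by
          rw [hRk]
          field_simp
          ring
        have e2 : (2 : ℝ) ^ k ≤ 2 ^ (k + 1) := pow_le_pow_right₀ (by norm_num) (by omega)
        have e3 : (0 : ℝ) < 2 ^ (k + 1) := by positivity
        rw [le_div_iff₀ hη]
        nlinarith
      have h1 : 2 ^ k ≤ ⌈ρ / η⌉₊ := by
        have := le_trans h2k (Nat.le_ceil (ρ / η))
        exact_mod_cast this
      have h2 := Nat.lt_pow_succ_log_self (b := 2) (by norm_num) ⌈ρ / η⌉₊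
      exact (Nat.pow_lt_pow_iff_right (by norm_num)).1 (lt_of_le_of_lt h1 h2)
    simp only [Set.mem_iUnion, Finset.mem_range]
    refine ⟨e₀, (mem_markedEdges_toFinset_W3M hE w e₀).2 he₀, k, hkL, ?_⟩
    rw [hG]
    simp only [Set.mem_setOf_eq, Set.mem_inter_iff]
    rw [dist_comm] at hd
    refine ⟨hge, ?_, ?_⟩
    · exact ufrsStrands_mono_W3M E w 2 hd (by linarith) (by linarith) h₁
    · exact ufrsStrands_mono_W3M E w 2 hd (by linarith) (by linarith) h₂
  -- summation
  calc μ.real {ω : BondConfig (Site 2) | ∃ z ∈ Ω, infDist z Ωᶜ < 3 * η ∧ z ∈ ufrsMarkedNbhd E w (4 * η) ∧ ∃ R' : ℝ, (∃ k : ℕ, R' = ρ / 2 / 2 / 2 ^ (k + 1)) ∧ 32 * (4 * η) ≤ R' ∧ ω ∈ ufrsStrands E w z 2 (4 * η) R' ∧ ω ∈ ufrsStrands E w z 2 (4 * R') (ρ / 2 / 2)}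
      ≤ μ.real (⋃ e₀ ∈ M, ⋃ k ∈ Finset.range L, G e₀ k) := measureReal_mono hcover (measure_ne_top _ _)
    _ ≤ ∑ e₀ ∈ M, μ.real (⋃ k ∈ Finset.range L, G e₀ k) := measureReal_biUnion_finset_le _ _
    _ ≤ ∑ e₀ ∈ M, ∑ k ∈ Finset.range L, μ.real (G e₀ k) :=
        Finset.sum_le_sum fun e₀ _ => measureReal_biUnion_finset_le _ _
    _ ≤ ∑ e₀ ∈ M, ∑ _k ∈ Finset.range L, C ^ 2 * (1024 * η / ρ) ^ β :=
        Finset.sum_le_sum fun e₀ he₀ => Finset.sum_le_sum fun k _ => hterm e₀ he₀ k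
    _ = (M.card : ℝ) * ((L : ℝ) * (C ^ 2 * (1024 * η / ρ) ^ β)) := by
        rw [Finset.sum_const, nsmul_eq_mul, Finset.sum_const, nsmul_eq_mul, Finset.card_range]
    _ ≤ 4 * ((L : ℝ) * (C ^ 2 * (1024 * η / ρ) ^ β)) := by
        refine mul_le_mul_of_nonneg_right ?_ (by positivity)
        exact_mod_cast card_markedEdges_le_W3M hE w
    _ = 4 * ((Nat.log 2 ⌈ρ / η⌉₊ + 1 : ℕ) : ℝ) * C ^ 2 * (1024 * η / ρ) ^ β := by
        rw [hL]
        ring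

end

end Summit.CriticalPhenomena.CardyFormulaZ2.Cruxes.EdgePrecompact.QkzStripBoundaryArm
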